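import Summits.CriticalPhenomena.PercolationContinuityZ3.Theorems.PercNearOneGluingNoHeavyLowerTailTwoPartitionKleitman
import Mathlib.Tactic.Linarith
import HarnessLib.Audit

/-!
# `NoHeavyLowerTail` (crux stmt-CriticalPhenomena-4575), master-family hierarchy P3 (gen 27): the one-sided sandwich inequality
# KEY — the two-up-set matching form, its two Harris–Kleitman faces, and the statement as a conjecture

Support file (seat `prim-masterthm-p3`; `--supports stmt-CriticalPhenomena-4575`; memo
`run/shared/lean/prim/prim-masterthm/FROM-prim-masterthm-p3-g27-KEY-TWO-LAYER.md`, HIERARCHY §35, `KEY-REDUCTION-g26.md`).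

THE STATEMENT (gen 26, `KEY-REDUCTION-g26.md` §4): for up-sets `𝒴, ℬ, 𝒞` of a finite cube, with the antipode `S ↦ Sᶜ`,
  `#(𝒴 ∩ ℬ ∩ 𝒞) − #(𝒴 ∩ (ℬ ∩ 𝒞)ᶜˢ) ≥ #{S ∈ 𝒴 : (every T ⊆ S with T ∈ 𝒴 lies in ℬ) and Sᶜ ∈ 𝒞 ∖ ℬ}`            (`KeyIneq`).
Gen 26 proved on paper (elementary, complete): `KeyIneq ⟹ WeightedBase ⟹ ThreeSetAntipodal ⟹ SQKD` (layer cake + Picard closure duality +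
one-sided decoupling; the last two implications are in the kernel: `…TwoPartitionWeightedBase`, `…TwoPartitionFibre`).

THE TWO-UP-SET FORM (this work, memo §1).  Dualising in `𝒞` and applying Hall's theorem, `KeyIneq` is equivalent (finite check: all triples of
`2^[n]`, `n ≤ 5`) to the following statement about TWO up-sets `𝒢, 𝒰`: with `ℋ := int(𝒢 ∪ 𝒰ᶜˢ)` (the largest up-set inside `𝒢 ∪ 𝒰ᶜˢ`,
`keyInterior`), targets `𝒯 := (𝒢 ∩ 𝒰) ∖ 𝒢ᶜˢ`, and sources `𝒮_b := (𝒰 ∩ 𝒢ᶜˢ) ∖ 𝒢`, `𝒮_a := ℋ ∖ (𝒢 ∪ 𝒰)`,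
  `#(𝒴 ∩ 𝒮_a) + #(𝒴 ∩ 𝒮_b) ≤ #(𝒴 ∩ 𝒯)`  for every up-set `𝒴`                                                        (`KeySandwich`),
i.e. an UPWARD INJECTION `𝒮_a ⊔ 𝒮_b ↪ 𝒯`; the slack at `𝒴 = ⊤` is the Kleitman quantity `twoPartN ((𝒰ᶜˢ)ᶜ) ℋ ≥ 0`.  It holds verbatim on every
finite product of chains tested (`[3]^3, [4]^2, [5]^2, [6]^2, [2,2,3], [2,2,4]`), i.e. it is a lattice statement, not a Boolean accident.
THIS FILE (all proved, standard axioms): the two KLEITMAN FACES of `KeySandwich` —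
  * `card_keySrcB_le` : `#(𝒴 ∩ 𝒮_b) ≤ #(𝒴 ∩ 𝒯)` (Harris–Kleitman for the up-sets `𝒴 ∩ 𝒰` and `𝒢`);
  * `card_keySrcA_add_le` : `#(𝒴 ∩ 𝒮_a) + #(𝒴 ∩ 𝒮_b ∩ ℋ) ≤ #(𝒴 ∩ 𝒯)` (Harris–Kleitman for `𝒴 ∩ ℋ` and `𝒢 ∪ (𝒰ᶜˢ)ᶜ`);
so each source class alone is matchable and the whole difficulty is the set `𝒮_b ∖ ℋ` (nonempty iff `𝒰 ∩ (𝒰ᶜˢ)ᶜ ⊄ 𝒢`), together with the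
corollary `keySandwich_of_srcB_subset` (KEY for every pair with `𝒮_b ⊆ ℋ`).  The general statements `KeySandwich`, `KeyIneq` are recorded as
`@[conjecture]`s — obligations, never facts.  EVIDENCE (not kernel): exhaustive `n ≤ 5` (5.7·10⁷ pairs), `1.28·10¹¹` pairs at `n = 6`
(all S₆-classes of `𝒢` × all `𝒰`, kit j253559), products of chains as above; the gen-27 memo records an inductive two-layer decomposition that
proves `KeySandwich` on `2^[n]` from `2^[n-1]` for `n ≤ 5` and the obstruction found at `n = 6`.
HONEST LABEL: a reformulation with its easy faces; nothing here bears on the crux or on Sahi's `C₃`. [this work]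
-/

namespace Summit.CriticalPhenomena.PercolationContinuityZ3.Theorems.TwoPartition

open Finset
open scoped FinsetFamily

variable {α : Type*} [DecidableEq α] [Fintype α]

/-- The largest up-set contained in a family: `int 𝒳 = {S : every T ⊇ S lies in 𝒳}`. [this work] -/
def keyInterior (𝒳 : Finset (Finset α)) : Finset (Finset α) := univ.filter fun S => ∀ T : Finset α, S ⊆ T → T ∈ 𝒳

/-- KEY targets `𝒯 = (𝒢 ∩ 𝒰) ∖ 𝒢ᶜˢ`: members of both up-sets whose complement is not in `𝒢`. [this work] -/
def keyTargets (𝒢 𝒰 : Finset (Finset α)) : Finset (Finset α) := (𝒢 ∩ 𝒰) \ 𝒢ᶜˢ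

/-- KEY sources of the first kind `𝒮_b = (𝒰 ∩ 𝒢ᶜˢ) ∖ 𝒢` (the Kleitman sources of `𝒢` that lie in `𝒰`). [this work] -/
def keySrcB (𝒢 𝒰 : Finset (Finset α)) : Finset (Finset α) := (𝒰 ∩ 𝒢ᶜˢ) \ 𝒢

/-- KEY sources of the second kind `𝒮_a = int(𝒢 ∪ 𝒰ᶜˢ) ∖ (𝒢 ∪ 𝒰)`. [this work] -/
def keySrcA (𝒢 𝒰 : Finset (Finset α)) : Finset (Finset α) := keyInterior (𝒢 ∪ 𝒰ᶜˢ) \ (𝒢 ∪ 𝒰)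

/-- **CONJECTURE `KeySandwich`** (this work; open): the two-up-set matching form of KEY — for all up-sets `𝒢, 𝒰, 𝒴` of a finite cube,
`#(𝒴 ∩ 𝒮_a) + #(𝒴 ∩ 𝒮_b) ≤ #(𝒴 ∩ 𝒯)` (equivalently: an upward injection `𝒮_a ⊔ 𝒮_b ↪ 𝒯`).  Verified for all pairs of up-sets of `2^[n]`,
`n ≤ 5`, and for `1.28·10¹¹` pairs at `n = 6`; implies `KeyIneq`, hence `WeightedBase`, `ThreeSetAntipodal`, SQKD (memo).  An obligation /
hypothesis — never a fact. [this work] [status: open] -/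
@[conjecture] def KeySandwich : Prop :=
  ∀ (n : ℕ) (𝒢 𝒰 𝒴 : Finset (Finset (Fin n))), IsUpperSet (𝒢 : Set (Finset (Fin n))) → IsUpperSet (𝒰 : Set (Finset (Fin n))) →
    IsUpperSet (𝒴 : Set (Finset (Fin n))) → #(𝒴 ∩ keySrcA 𝒢 𝒰) + #(𝒴 ∩ keySrcB 𝒢 𝒰) ≤ #(𝒴 ∩ keyTargets 𝒢 𝒰)

/-- **CONJECTURE `KeyIneq`** (gen 26, `KEY-REDUCTION-g26.md`; open): for up-sets `𝒴, ℬ, 𝒞`,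
`#{S ∈ 𝒴 : ↓S ∩ 𝒴 ⊆ ℬ, Sᶜ ∈ 𝒞 ∖ ℬ} ≤ #(𝒴 ∩ ℬ ∩ 𝒞) − #(𝒴 ∩ (ℬ ∩ 𝒞)ᶜˢ)`.  Implies `WeightedBase` (paper proof, gen 26) and is implied by
`KeySandwich` (paper proof, this memo §1).  An obligation / hypothesis — never a fact. [this work] [status: open] -/
@[conjecture] def KeyIneq : Prop :=
  ∀ (n : ℕ) (𝒴 ℬ 𝒞 : Finset (Finset (Fin n))), IsUpperSet (𝒴 : Set (Finset (Fin n))) → IsUpperSet (ℬ : Set (Finset (Fin n))) →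
    IsUpperSet (𝒞 : Set (Finset (Fin n))) →
      #(𝒴.filter fun S => (∀ T ∈ 𝒴, T ⊆ S → T ∈ ℬ) ∧ Sᶜ ∈ 𝒞 ∧ Sᶜ ∉ ℬ) + #(𝒴 ∩ (ℬ ∩ 𝒞)ᶜˢ) ≤ #(𝒴 ∩ ℬ ∩ 𝒞)

/-! ### Elementary properties of the interior -/

omit [DecidableEq α] in
/-- Membership in the interior. [this work] -/
theorem mem_keyInterior [DecidableEq α] {𝒳 : Finset (Finset α)} {S : Finset α} :
    S ∈ keyInterior 𝒳 ↔ ∀ T : Finset α, S ⊆ T → T ∈ 𝒳 := by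
  simp [keyInterior]

/-- The interior is an up-set. [this work] -/
theorem isUpperSet_keyInterior (𝒳 : Finset (Finset α)) : IsUpperSet (keyInterior 𝒳 : Set (Finset α)) := by
  intro S T hST hS
  rw [Finset.mem_coe, mem_keyInterior] at hS ⊢
  exact fun R hTR => hS R (hST.trans hTR)

/-- The interior is contained in the family. [this work] -/
theorem keyInterior_subset (𝒳 : Finset (Finset α)) : keyInterior 𝒳 ⊆ 𝒳 := fun S hS =>
  (mem_keyInterior.1 hS) S Subset.rfl

/-- An up-set contained in `𝒳` is contained in its interior. [this work] -/
theorem subset_keyInterior {𝒳 𝒢 : Finset (Finset α)} (h𝒢 : IsUpperSet (𝒢 : Set (Finset α))) (h : 𝒢 ⊆ 𝒳) :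
    𝒢 ⊆ keyInterior 𝒳 := by
  intro S hS
  rw [mem_keyInterior]
  exact fun T hST => h (h𝒢 hST hS)

/-! ### The first Kleitman face: the sources `𝒮_b` alone -/

/-- **First face** (this work): `#(𝒴 ∩ 𝒮_b) ≤ #(𝒴 ∩ 𝒯)` for all up-sets — the Harris–Kleitman sandwich `twoPartN (𝒴 ∩ 𝒰) 𝒢 ≥ 0` with the common
part `𝒴 ∩ 𝒰 ∩ 𝒢 ∩ 𝒢ᶜˢ` cancelled.  So the sources `𝒮_b` alone always fit into the targets. [this work] -/
theorem card_keySrcB_le {𝒢 𝒰 𝒴 : Finset (Finset α)} (h𝒢 : IsUpperSet (𝒢 : Set (Finset α))) (h𝒰 : IsUpperSet (𝒰 : Set (Finset α)))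
    (h𝒴 : IsUpperSet (𝒴 : Set (Finset α))) : #(𝒴 ∩ keySrcB 𝒢 𝒰) ≤ #(𝒴 ∩ keyTargets 𝒢 𝒰) := by
  have hYU : IsUpperSet ((𝒴 ∩ 𝒰 : Finset (Finset α)) : Set (Finset α)) := by
    rw [Finset.coe_inter]; exact h𝒴.inter h𝒰
  have h := twoPartN_nonneg hYU h𝒢
  unfold twoPartN at h
  -- split both counts along the common part `𝒴 ∩ 𝒰 ∩ 𝒢 ∩ 𝒢ᶜˢ`
  have e1 := card_filter_add_card_filter_not (s := 𝒴 ∩ 𝒰 ∩ 𝒢) (fun S => S ∈ 𝒢ᶜˢ)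
  have e2 := card_filter_add_card_filter_not (s := 𝒴 ∩ 𝒰 ∩ 𝒢ᶜˢ) (fun S => S ∈ 𝒢)
  have f1 : (𝒴 ∩ 𝒰 ∩ 𝒢).filter (fun S => S ∈ 𝒢ᶜˢ) = (𝒴 ∩ 𝒰 ∩ 𝒢ᶜˢ).filter (fun S => S ∈ 𝒢) := by
    ext S; simp only [mem_filter, mem_inter]; tauto
  have f2 : (𝒴 ∩ 𝒰 ∩ 𝒢).filter (fun S => ¬ S ∈ 𝒢ᶜˢ) = 𝒴 ∩ keyTargets 𝒢 𝒰 := by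
    ext S; simp only [mem_filter, mem_inter, keyTargets, mem_sdiff]; tauto
  have f3 : (𝒴 ∩ 𝒰 ∩ 𝒢ᶜˢ).filter (fun S => ¬ S ∈ 𝒢) = 𝒴 ∩ keySrcB 𝒢 𝒰 := by
    ext S; simp only [mem_filter, mem_inter, keySrcB, mem_sdiff]; tauto
  rw [f1] at e1
  rw [f2] at e1
  rw [f3] at e2
  have c1 : (#(𝒴 ∩ 𝒰 ∩ 𝒢) : ℤ) = #((𝒴 ∩ 𝒰 ∩ 𝒢ᶜˢ).filter (fun S => S ∈ 𝒢)) + #(𝒴 ∩ keyTargets 𝒢 𝒰) := by exact_mod_cast e1.symm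
  have c2 : (#(𝒴 ∩ 𝒰 ∩ 𝒢ᶜˢ) : ℤ) = #((𝒴 ∩ 𝒰 ∩ 𝒢ᶜˢ).filter (fun S => S ∈ 𝒢)) + #(𝒴 ∩ keySrcB 𝒢 𝒰) := by exact_mod_cast e2.symm
  have : (#(𝒴 ∩ keySrcB 𝒢 𝒰) : ℤ) ≤ #(𝒴 ∩ keyTargets 𝒢 𝒰) := by linarith
  exact_mod_cast this

/-! ### The second Kleitman face: the sources `𝒮_a` together with the part of `𝒮_b` inside the interior -/

/-- The family `(𝒰ᶜˢ)ᶜ = {S : Sᶜ ∉ 𝒰}` (written as a filter); for an up-set `𝒰` it is an up-set. [this work] -/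
def keyDual (𝒰 : Finset (Finset α)) : Finset (Finset α) := univ.filter fun S => Sᶜ ∉ 𝒰

omit [DecidableEq α] in
/-- Membership in `keyDual`. [this work] -/
theorem mem_keyDual [DecidableEq α] {𝒰 : Finset (Finset α)} {S : Finset α} : S ∈ keyDual 𝒰 ↔ Sᶜ ∉ 𝒰 := by
  simp [keyDual]

/-- `keyDual 𝒰` is an up-set when `𝒰` is. [this work] -/
theorem isUpperSet_keyDual {𝒰 : Finset (Finset α)} (h𝒰 : IsUpperSet (𝒰 : Set (Finset α))) :
    IsUpperSet (keyDual 𝒰 : Set (Finset α)) := by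
  intro S T hST hS
  rw [Finset.mem_coe, mem_keyDual] at hS ⊢
  exact fun hT => hS (h𝒰 (compl_subset_compl.2 hST) hT)

/-- **Second face** (this work): `#(𝒴 ∩ 𝒮_a) + #(𝒴 ∩ 𝒮_b ∩ ℋ) ≤ #(𝒴 ∩ 𝒯)` — the Harris–Kleitman sandwich for the up-sets `𝒴 ∩ ℋ` and
`𝒢 ∪ keyDual 𝒰`, using `ℋ ∩ keyDual 𝒰 ⊆ 𝒢 ⊆ ℋ`.  So the sources `𝒮_a`, and even `𝒮_a` together with the `𝒮_b`-sources inside the interior,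
always fit into the targets; the whole difficulty of `KeySandwich` is the set `𝒮_b ∖ ℋ`. [this work] -/
theorem card_keySrcA_add_le {𝒢 𝒰 𝒴 : Finset (Finset α)} (h𝒢 : IsUpperSet (𝒢 : Set (Finset α))) (h𝒰 : IsUpperSet (𝒰 : Set (Finset α)))
    (h𝒴 : IsUpperSet (𝒴 : Set (Finset α))) :
    #(𝒴 ∩ keySrcA 𝒢 𝒰) + #(𝒴 ∩ keySrcB 𝒢 𝒰 ∩ keyInterior (𝒢 ∪ 𝒰ᶜˢ)) ≤ #(𝒴 ∩ keyTargets 𝒢 𝒰) := by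
  set ℋ := keyInterior (𝒢 ∪ 𝒰ᶜˢ) with hℋ
  have hHup : IsUpperSet (ℋ : Set (Finset α)) := isUpperSet_keyInterior _
  have hGH : 𝒢 ⊆ ℋ := subset_keyInterior h𝒢 subset_union_left
  -- ℋ ∩ keyDual 𝒰 ⊆ 𝒢
  have hHV : ∀ S, S ∈ ℋ → Sᶜ ∉ 𝒰 → S ∈ 𝒢 := by
    intro S hS hSc
    have h1 : S ∈ 𝒢 ∪ 𝒰ᶜˢ := keyInterior_subset _ hS
    rw [mem_union, mem_compls] at h1
    exact h1.resolve_right hSc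
  have hYH : IsUpperSet ((𝒴 ∩ ℋ : Finset (Finset α)) : Set (Finset α)) := by
    rw [Finset.coe_inter]; exact h𝒴.inter hHup
  have hGV : IsUpperSet ((𝒢 ∪ keyDual 𝒰 : Finset (Finset α)) : Set (Finset α)) := by
    rw [Finset.coe_union]; exact h𝒢.union (isUpperSet_keyDual h𝒰)
  have h := twoPartN_nonneg hYH hGV
  unfold twoPartN at h
  -- the positive part is `𝒴 ∩ 𝒢`
  have p1 : 𝒴 ∩ ℋ ∩ (𝒢 ∪ keyDual 𝒰) = 𝒴 ∩ 𝒢 := by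
    ext S
    simp only [mem_inter, mem_union, mem_keyDual]
    constructor
    · rintro ⟨⟨hY, hH⟩, hGV⟩
      exact ⟨hY, hGV.elim id (hHV S hH)⟩
    · rintro ⟨hY, hG⟩
      exact ⟨⟨hY, hGH hG⟩, Or.inl hG⟩
  -- the negative part, as a filter
  have p2 : 𝒴 ∩ ℋ ∩ (𝒢 ∪ keyDual 𝒰)ᶜˢ = (𝒴 ∩ ℋ).filter (fun S => S ∈ 𝒢ᶜˢ ∨ S ∉ 𝒰) := by
    ext S
    simp only [mem_inter, mem_filter, mem_compls, mem_union, mem_keyDual, compl_compl]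
  rw [p1, p2] at h
  -- split `𝒴 ∩ 𝒢` by the predicate `S ∈ 𝒢ᶜˢ ∨ S ∉ 𝒰`
  have e1 := card_filter_add_card_filter_not (s := 𝒴 ∩ 𝒢) (fun S => S ∈ 𝒢ᶜˢ ∨ S ∉ 𝒰)
  have f1 : (𝒴 ∩ 𝒢).filter (fun S => ¬ (S ∈ 𝒢ᶜˢ ∨ S ∉ 𝒰)) = 𝒴 ∩ keyTargets 𝒢 𝒰 := by
    ext S; simp only [mem_filter, mem_inter, keyTargets, mem_sdiff, not_or, not_not]; tauto
  -- split the negative part by membership in `𝒢`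
  have e2 := card_filter_add_card_filter_not (s := (𝒴 ∩ ℋ).filter (fun S => S ∈ 𝒢ᶜˢ ∨ S ∉ 𝒰)) (fun S => S ∈ 𝒢)
  have f2 : ((𝒴 ∩ ℋ).filter (fun S => S ∈ 𝒢ᶜˢ ∨ S ∉ 𝒰)).filter (fun S => S ∈ 𝒢) =
      (𝒴 ∩ 𝒢).filter (fun S => S ∈ 𝒢ᶜˢ ∨ S ∉ 𝒰) := by
    ext S; simp only [mem_filter, mem_inter]
    constructor
    · rintro ⟨⟨⟨hY, _⟩, hor⟩, hG⟩; exact ⟨⟨hY, hG⟩, hor⟩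
    · rintro ⟨⟨hY, hG⟩, hor⟩; exact ⟨⟨⟨hY, hGH hG⟩, hor⟩, hG⟩
  -- the part outside `𝒢` splits into `𝒮_a` (those outside `𝒰`) and `𝒮_b ∩ ℋ` (those inside `𝒰`)
  have e3 := card_filter_add_card_filter_not
    (s := ((𝒴 ∩ ℋ).filter (fun S => S ∈ 𝒢ᶜˢ ∨ S ∉ 𝒰)).filter (fun S => ¬ S ∈ 𝒢)) (fun S => S ∈ 𝒰)
  have f3 : (((𝒴 ∩ ℋ).filter (fun S => S ∈ 𝒢ᶜˢ ∨ S ∉ 𝒰)).filter (fun S => ¬ S ∈ 𝒢)).filter (fun S => S ∈ 𝒰) =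
      𝒴 ∩ keySrcB 𝒢 𝒰 ∩ ℋ := by
    ext S; simp only [mem_filter, mem_inter, keySrcB, mem_sdiff]; tauto
  have f4 : (((𝒴 ∩ ℋ).filter (fun S => S ∈ 𝒢ᶜˢ ∨ S ∉ 𝒰)).filter (fun S => ¬ S ∈ 𝒢)).filter (fun S => ¬ S ∈ 𝒰) =
      𝒴 ∩ keySrcA 𝒢 𝒰 := by
    ext S; simp only [mem_filter, mem_inter, keySrcA, mem_sdiff, mem_union, not_or, hℋ]; tauto
  rw [f1] at e1; rw [f2] at e2; rw [f3, f4] at e3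
  have c1 : (#(𝒴 ∩ 𝒢) : ℤ) = #((𝒴 ∩ 𝒢).filter (fun S => S ∈ 𝒢ᶜˢ ∨ S ∉ 𝒰)) + #(𝒴 ∩ keyTargets 𝒢 𝒰) := by exact_mod_cast e1.symm
  have c2 : (#((𝒴 ∩ ℋ).filter (fun S => S ∈ 𝒢ᶜˢ ∨ S ∉ 𝒰)) : ℤ) =
      #((𝒴 ∩ 𝒢).filter (fun S => S ∈ 𝒢ᶜˢ ∨ S ∉ 𝒰)) +
        #(((𝒴 ∩ ℋ).filter (fun S => S ∈ 𝒢ᶜˢ ∨ S ∉ 𝒰)).filter (fun S => ¬ S ∈ 𝒢)) := by exact_mod_cast e2.symm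
  have c3 : (#(((𝒴 ∩ ℋ).filter (fun S => S ∈ 𝒢ᶜˢ ∨ S ∉ 𝒰)).filter (fun S => ¬ S ∈ 𝒢)) : ℤ) =
      #(𝒴 ∩ keySrcB 𝒢 𝒰 ∩ ℋ) + #(𝒴 ∩ keySrcA 𝒢 𝒰) := by exact_mod_cast e3.symm
  have : (#(𝒴 ∩ keySrcA 𝒢 𝒰) : ℤ) + #(𝒴 ∩ keySrcB 𝒢 𝒰 ∩ ℋ) ≤ #(𝒴 ∩ keyTargets 𝒢 𝒰) := by linarith
  exact_mod_cast this

/-- **Corollary** (this work): `KeySandwich` holds for every pair `(𝒢, 𝒰)` whose `𝒮_b`-sources all lie in the interior `int(𝒢 ∪ 𝒰ᶜˢ)` — in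
particular whenever `𝒰 ∩ keyDual 𝒰 ⊆ 𝒢`. [this work] -/
theorem keySandwich_of_srcB_subset {𝒢 𝒰 𝒴 : Finset (Finset α)} (h𝒢 : IsUpperSet (𝒢 : Set (Finset α)))
    (h𝒰 : IsUpperSet (𝒰 : Set (Finset α))) (h𝒴 : IsUpperSet (𝒴 : Set (Finset α)))
    (hb : keySrcB 𝒢 𝒰 ⊆ keyInterior (𝒢 ∪ 𝒰ᶜˢ)) :
    #(𝒴 ∩ keySrcA 𝒢 𝒰) + #(𝒴 ∩ keySrcB 𝒢 𝒰) ≤ #(𝒴 ∩ keyTargets 𝒢 𝒰) := by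
  have h := card_keySrcA_add_le (𝒴 := 𝒴) h𝒢 h𝒰 h𝒴
  have e : 𝒴 ∩ keySrcB 𝒢 𝒰 ∩ keyInterior (𝒢 ∪ 𝒰ᶜˢ) = 𝒴 ∩ keySrcB 𝒢 𝒰 :=
    inter_eq_left.2 fun S hS => hb (mem_inter.1 hS).2
  rwa [e] at h

/-- If `𝒰 ∩ keyDual 𝒰 ⊆ 𝒢` (every member of `𝒰` whose complement is outside `𝒰` already lies in `𝒢`), the `𝒮_b`-sources lie in the interior,
so `KeySandwich` holds for `(𝒢, 𝒰)`. [this work] -/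
theorem keySandwich_of_inter_keyDual_subset {𝒢 𝒰 𝒴 : Finset (Finset α)} (h𝒢 : IsUpperSet (𝒢 : Set (Finset α)))
    (h𝒰 : IsUpperSet (𝒰 : Set (Finset α))) (h𝒴 : IsUpperSet (𝒴 : Set (Finset α))) (hW : 𝒰 ∩ keyDual 𝒰 ⊆ 𝒢) :
    #(𝒴 ∩ keySrcA 𝒢 𝒰) + #(𝒴 ∩ keySrcB 𝒢 𝒰) ≤ #(𝒴 ∩ keyTargets 𝒢 𝒰) := by
  refine keySandwich_of_srcB_subset h𝒢 h𝒰 h𝒴 fun S hS => ?_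
  rw [keySrcB, mem_sdiff, mem_inter] at hS
  rw [mem_keyInterior]
  intro T hST
  rw [mem_union, mem_compls]
  by_cases hT : Tᶜ ∈ 𝒰
  · exact Or.inr hT
  · exact Or.inl (hW (mem_inter.2 ⟨h𝒰 hST hS.1.1, mem_keyDual.2 hT⟩))

end Summit.CriticalPhenomena.PercolationContinuityZ3.Theorems.TwoPartition
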